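import Mathlib

/-!
# The FTCS heat step at the stability-limit time step IS the simple random walk (Linden–Montanaro–Shao)

Topic `Literature/Analysis/PDE`.  Source: N. Linden, A. Montanaro, C. Shao, *Quantum vs. Classical
Algorithms for Solving the Heat Equation*, Commun. Math. Phys. 395 (2022) 601–641 = arXiv:2004.06516
[LindenMontanaroShao2022] (held text `paper:arxiv-2004.06516`, read by the lead): §1.1 (chunk p0005)
the forward-time central-space (FTCS) discretisation of `∂u/∂t = α ∇²u` on the periodic lattice `ℤ_n^d`,
"`(u(x, t+Δt) − u(x, t))/Δt = (α/Δx²) Σ_{i=1}^d (u(…, x_i+Δx, …, t) + u(…, x_i−Δx, …, t) − 2u(x, t))`",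
with the remarks "Observe that, with these choices [`Δt = Δx²/(2dα)`], the operator `𝓛` is precisely a
simple random walk on `ℤ_n^d`" (p0005 L91) and "the linear time-evolution operator `𝓛` … cannot increase
the infinity-norm" (p0005 L89); §2.2 "Random walk method" (p0009 L44): "the linear operator `𝓛`
corresponding to evolving in time by one step is stochastic, so this process can be understood as a random
walk.  Given a sample from a distribution corresponding to the initial condition `u₀`, one can iterate the
random walk `m` times to produce samples from distributions corresponding to each of the subsequent time
steps" — the basis of their Lemma 9 / Theorem 10 (the classical random-walk estimator, `O(1/ε²)` samples,
no stored grid).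

HONEST FRAMING (pub-qadeq lane context: the mesh-free CLASSICAL comparator — trajectory / random-walk
Monte Carlo — that the quantum-PDE rows A-244 (parabolic observables), A-249 (method of lines), A-118
(LMS itself) and, via characteristics, A-245 (Liouville) are read against): instance-level adjudication
of specific advantage claims; no claim about BQP vs BPP or the summit.  This file proves exact algebraic
identities for the discrete scheme; it says nothing about any device, about continuum error (LMS Thm 1) or
about sampling error (LMS Thm 10's Chernoff step).

## Contents (all proved, 0 named facts)

* `shift`, `heatStep` — the FTCS update `u ↦ u + r Σ_i (u(·+e_i) + u(·−e_i) − 2u)` on `Fin d → ZMod n`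
  with mesh ratio `r = αΔt/Δx²`; `walkStep` — the simple-random-walk transition operator
  `u ↦ (1/2d) Σ_i (u(·+e_i) + u(·−e_i))`.
* **`heatStep_eq_walkStep`** — at `r = 1/(2d)` the FTCS step IS the walk operator [cite: LindenMontanaroShao2022, §1.1 (p0005 L91)].
* `sum_shift`, **`sum_walkStep`** (total heat is conserved: the operator is doubly stochastic),
  `walkStep_nonneg`, **`abs_walkStep_le`** ("cannot increase the infinity-norm"),
  `heatStep_nonneg_of_le` (monotonicity for any `r ≤ 1/(2d)`, the hypothesis of LMS Thm 1).
* `move`, **`walkStep_iterate_eq_sum_paths`** — the random-walk representation of `m` time steps: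
  `(𝓛^m u)(x) = (2d)^{-m} Σ_{ω : Fin m → Fin d × Bool} u(x + Σ_j move(ω_j))`, i.e. `𝓛^m u (x)` is the
  expectation of `u` at the endpoint of an `m`-step simple random walk started at `x` — the identity behind
  LMS Lemma 9 / Theorem 10 (sample a walk, average `u₀` at its endpoint) [cite: LindenMontanaroShao2022, §2.2 Lemma 9].
-/

noncomputable section

open Finset

namespace Literature.Analysis.PDE.HeatRandomWalk

variable {d n : ℕ}

/-- The lattice point `x` shifted by `±1` in coordinate `i` (periodic lattice `ℤ_n^d`). [cite: LindenMontanaroShao2022, §1.1 (the stencil `x_i ± Δx`)] -/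
def shift (x : Fin d → ZMod n) (i : Fin d) (s : ℤ) : Fin d → ZMod n := x + Pi.single i (s : ZMod n)

/-- The unit move of the simple random walk encoded by a coordinate and a sign. [cite: LindenMontanaroShao2022, §2.2] -/
def move (c : Fin d × Bool) : Fin d → ZMod n := Pi.single c.1 (if c.2 then 1 else -1)

/-- One FTCS time step with mesh ratio `r = αΔt/Δx²`:
`u(x, t+Δt) = u(x, t) + r Σ_i (u(x+e_i) + u(x−e_i) − 2u(x))`. [cite: LindenMontanaroShao2022, §1.1 eq. (lincons), p0005] -/
def heatStep (r : ℝ) (u : (Fin d → ZMod n) → ℝ) (x : Fin d → ZMod n) : ℝ :=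
  u x + r * ∑ i : Fin d, (u (shift x i 1) + u (shift x i (-1)) - 2 * u x)

/-- The transition operator of the simple random walk on `ℤ_n^d`: average of `u` over the `2d` neighbours.
[cite: LindenMontanaroShao2022, §1.1 p0005 L91 / §2.2] -/
def walkStep (u : (Fin d → ZMod n) → ℝ) (x : Fin d → ZMod n) : ℝ :=
  (1 / (2 * d : ℝ)) * ∑ i : Fin d, (u (shift x i 1) + u (shift x i (-1)))

/-- **"With these choices the operator 𝓛 is precisely a simple random walk on ℤ_n^d"**: at the stability
limit `r = αΔt/Δx² = 1/(2d)` the FTCS step equals the walk operator (the `−2u(x)` terms cancel `u(x)`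
exactly). [cite: LindenMontanaroShao2022, §1.1 (p0005 L91), Thm 1 hypothesis `Δt ≤ Δx²/(2dα)`] -/
theorem heatStep_eq_walkStep (hd : 0 < d) (u : (Fin d → ZMod n) → ℝ) (x : Fin d → ZMod n) :
    heatStep (1 / (2 * d : ℝ)) u x = walkStep u x := by
  unfold heatStep walkStep
  have hd' : (d : ℝ) ≠ 0 := by exact_mod_cast hd.ne'
  rw [Finset.sum_sub_distrib]
  simp only [Finset.sum_const, Finset.card_univ, Fintype.card_fin, nsmul_eq_mul]
  field_simp
  ring

/-- Translating the lattice permutes it: `Σ_x u(x + v) = Σ_x u(x)` (plumbing). [folklore] -/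
private theorem sum_comp_add [NeZero n] (u : (Fin d → ZMod n) → ℝ) (v : Fin d → ZMod n) :
    ∑ x, u (x + v) = ∑ x, u x :=
  Fintype.sum_equiv (Equiv.addRight v) _ _ (fun _ => rfl)

/-- `Σ_x u(shift x i s) = Σ_x u(x)` (plumbing). [folklore] -/
private theorem sum_shift [NeZero n] (u : (Fin d → ZMod n) → ℝ) (i : Fin d) (s : ℤ) :
    ∑ x, u (shift x i s) = ∑ x, u x := by
  unfold shift; exact sum_comp_add u _

/-- **Conservation of total heat / the walk operator is doubly stochastic**: `Σ_x (𝓛u)(x) = Σ_x u(x)`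
(for `d ≥ 1`). [cite: LindenMontanaroShao2022, §2.2 ("the linear operator 𝓛 … is stochastic")] -/
theorem sum_walkStep [NeZero n] (hd : 0 < d) (u : (Fin d → ZMod n) → ℝ) : ∑ x, walkStep u x = ∑ x, u x := by
  unfold walkStep
  rw [← Finset.mul_sum, Finset.sum_comm]
  simp_rw [Finset.sum_add_distrib, sum_shift]
  simp only [Finset.sum_const, Finset.card_univ, Fintype.card_fin, nsmul_eq_mul]
  have hd' : (d : ℝ) ≠ 0 := by exact_mod_cast hd.ne'
  field_simp
  ring

/-- Positivity: `u ≥ 0 ⇒ 𝓛u ≥ 0` (the operator has non-negative entries). [cite: LindenMontanaroShao2022, §2.2 (stochastic)] -/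
theorem walkStep_nonneg (u : (Fin d → ZMod n) → ℝ) (hu : ∀ y, 0 ≤ u y) (x : Fin d → ZMod n) :
    0 ≤ walkStep u x := by
  unfold walkStep
  refine mul_nonneg (by positivity) (Finset.sum_nonneg fun i _ => add_nonneg (hu _) (hu _))

/-- **"The linear time-evolution operator 𝓛 cannot increase the infinity-norm"**: if `|u| ≤ M` everywhere
then `|𝓛u| ≤ M` everywhere (for `d ≥ 1`). [cite: LindenMontanaroShao2022, §1.1 (p0005 L89)] -/
theorem abs_walkStep_le (hd : 0 < d) (u : (Fin d → ZMod n) → ℝ) (M : ℝ) (hu : ∀ y, |u y| ≤ M)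
    (x : Fin d → ZMod n) : |walkStep u x| ≤ M := by
  unfold walkStep
  have hdpos : (0 : ℝ) < 2 * d := by positivity
  rw [abs_mul, abs_of_pos (by positivity : (0:ℝ) < 1 / (2 * d))]
  have hsum : |∑ i : Fin d, (u (shift x i 1) + u (shift x i (-1)))| ≤ ∑ _i : Fin d, (M + M) := by
    refine (Finset.abs_sum_le_sum_abs _ _).trans (Finset.sum_le_sum fun i _ => ?_)
    exact (abs_add_le _ _).trans (add_le_add (hu _) (hu _))
  simp only [Finset.sum_const, Finset.card_univ, Fintype.card_fin, nsmul_eq_mul] at hsum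
  calc 1 / (2 * ↑d) * |∑ i : Fin d, (u (shift x i 1) + u (shift x i (-1)))|
      ≤ 1 / (2 * ↑d) * (↑d * (M + M)) := mul_le_mul_of_nonneg_left hsum (by positivity)
    _ = M := by field_simp; ring

/-- Monotonicity of the FTCS step under the stability condition `0 ≤ r ≤ 1/(2d)` (the hypothesis
`Δt ≤ Δx²/(2dα)` of LMS Theorem 1): non-negative data stay non-negative, because the step is the convex
combination `(1 − 2dr)·u(x) + r·Σ(neighbours)`. [cite: LindenMontanaroShao2022, Thm 1 (hypothesis)] -/
theorem heatStep_nonneg_of_le (r : ℝ) (hr0 : 0 ≤ r) (hr : 2 * d * r ≤ 1) (u : (Fin d → ZMod n) → ℝ)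
    (hu : ∀ y, 0 ≤ u y) (x : Fin d → ZMod n) : 0 ≤ heatStep r u x := by
  unfold heatStep
  rw [Finset.sum_sub_distrib]
  simp only [Finset.sum_const, Finset.card_univ, Fintype.card_fin, nsmul_eq_mul]
  have h1 : 0 ≤ ∑ i : Fin d, (u (shift x i 1) + u (shift x i (-1))) :=
    Finset.sum_nonneg fun i _ => add_nonneg (hu _) (hu _)
  have h2 : 0 ≤ (1 - 2 * d * r) * u x := mul_nonneg (by linarith) (hu x)
  nlinarith [h1, h2, hu x]

/-! ## The random-walk representation of `m` time steps -/

/-- One step as an expectation over the `2d` equally likely moves: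
`(𝓛u)(x) = (2d)⁻¹ Σ_{(i,b)} u(x + move(i,b))`. [cite: LindenMontanaroShao2022, §2.2 (Lemma 9, proof: "applying the stochastic map 𝓛 to x")] -/
theorem walkStep_eq_sum_moves (u : (Fin d → ZMod n) → ℝ) (x : Fin d → ZMod n) :
    walkStep u x = (1 / (2 * d : ℝ)) * ∑ c : Fin d × Bool, u (x + move c) := by
  unfold walkStep move shift
  congr 1
  rw [Fintype.sum_prod_type]
  refine Finset.sum_congr rfl fun i _ => ?_
  simp

/-- **Random-walk representation** (the identity behind the "random walk method", LMS Lemma 9 /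
Theorem 10): after `m` steps, `(𝓛^m u)(x) = (2d)^{-m} Σ_{ω : Fin m → Fin d × Bool} u(x + Σ_j move(ω_j))`
— the value is the expectation of `u` at the endpoint of an `m`-step simple random walk from `x`, each of
the `(2d)^m` step sequences being equally likely.  (Classically one SAMPLES `ω` and averages — no grid is
stored.) [cite: LindenMontanaroShao2022, §2.2 Lemma 9 / Thm 10] -/
theorem walkStep_iterate_eq_sum_paths (u : (Fin d → ZMod n) → ℝ) :
    ∀ (m : ℕ) (x : Fin d → ZMod n),
      (walkStep^[m] u) x = (1 / (2 * d : ℝ)) ^ m * ∑ ω : Fin m → Fin d × Bool, u (x + ∑ j, move (ω j))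
  | 0, x => by simp
  | m + 1, x => by
      rw [Function.iterate_succ_apply', walkStep_eq_sum_moves]
      have ih : ∀ c : Fin d × Bool, (walkStep^[m] u) (x + move c)
          = (1 / (2 * d : ℝ)) ^ m * ∑ ω : Fin m → Fin d × Bool, u (x + move c + ∑ j, move (ω j)) :=
        fun c => walkStep_iterate_eq_sum_paths u m (x + move c)
      simp_rw [ih]
      rw [← Finset.mul_sum, ← mul_assoc]
      have hpow : (1 / (2 * d : ℝ)) * (1 / (2 * d : ℝ)) ^ m = (1 / (2 * d : ℝ)) ^ (m + 1) := by ring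
      rw [hpow]
      congr 1
      rw [← Fintype.sum_prod_type' (f := fun c (ω : Fin m → Fin d × Bool) => u (x + move c + ∑ j, move (ω j)))]
      refine Fintype.sum_equiv (Fin.consEquiv fun _ => Fin d × Bool) _ _ (fun p => ?_)
      simp only [Fin.consEquiv_apply, Fin.sum_univ_succ, Fin.cons_zero, Fin.cons_succ, add_assoc]

end Literature.Analysis.PDE.HeatRandomWalk

end
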